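import Literature.Computability.AlgebraicComplexity.ConstituentStageStructure
import Literature.Computability.AlgebraicComplexity.HashedZeroOutHoles
import Literature.Computability.AlgebraicComplexity.InterfaceRelabel
import HarnessLib

/-!
# The constituent stage, one region, assembled in exact form: the input `ε`-interface tensor restricts
to independent copies of `𝒯*` (Vassilevska Williams–Xu–Xu–Zhou 2024, Prop. 6.2 / §6.6, one region) — proved

Topic `Literature/Computability/AlgebraicComplexity`.  End of §6.6 of Vassilevska Williams–Xu–Xu–Zhou,
*New bounds for matrix multiplication: from alpha to omega* (SODA 2024, arXiv:2307.07970): "Overall,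
we expect to get `numalpha · M^{−1−o(1)}` copies of `𝒯*` whose fraction of holes is `O(1/n²)`.  By
Cor. 4.2, we can degenerate them into `numalpha · M^{−1−o(1)}` unbroken copies of `𝒯*` because
`O(1/n²) ≤ 1/(8N)` for sufficiently large `n`" — the first region of **Proposition 6.2**.  This file
PROVES the assembly in EXACT (non-asymptotic) form for the data `D : ConstituentRegion c n s M` of one
region (`ConstituentStageStructure.lean`):

* `letterCount_pairTermIdx_eq_of_consistent` — two `{α_t}`-consistent triples of the universe have
  pair term maps with the same fibre sizes `|S_{t,i',j',k'}|`, so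
* `brokenStar_restrictsTo_refStar` — a broken copy of `𝒯*` over one of them, with hole sets in the
  three dimensions, restricts to a broken copy over the other with hole sets of the same sizes
  (relabelling the half-chunk positions, `InterfaceRelabel.interfaceTensor_relabel`);
* `input_restrictsTo_copies` — **for every `k, r` with
  `k · r ≤ #{T ∈ 𝒯'(ω) | second-type holes inside the input ≤ h}` (second-type holes outside the input
  are first-type holes, `firstTypeHolesZ_union_holes`),
  `r ≥ 8^{3⌊log_{2N} 3^N⌋+3}` (`N = c · 2n`) and hole budgets `8 N |firstTypeHolesX(T)| ≤ M_X`,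
  `8 N |firstTypeHolesY(T)| ≤ M_Y`, `8 N (|firstTypeHolesZ(T)| + h) ≤ M_Z` (the level-1 block counts of
  the reference `𝒯*`): `𝒯_{τ,L,ε} ≥ ⟨k⟩ ⊗ 𝒯*`** — the zero-outs (`input_restrictsTo_directSum`), `k`
  batches of `r` good broken copies (`summand_eq_brokenStar`), relabelling, and Cor. 4.2
  (`vxxz2024_cor42`) with holes in all three dimensions on each batch;
* `vxxz2024_prop62_region` — with the good seed of `HashedZeroOutHoles.lean` (Claims 6.7, 6.15, Markov)
  under the requirements on `M` (`8 numtriple ≤ M numxblock`, `8 numtriple ≤ M numyblock`,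
  `10 U(T) M^{2n−1} ≤ (h+1) M^{2n}`): **`𝒯_{τ,L,ε} ≥ ⟨⌊|B| · numalpha / (2 M² r)⌋⟩ ⊗ 𝒯*`** — the printed
  "`numalpha · M^{−1−o(1)}` unbroken copies of `𝒯*`" with all constants explicit.

Everything is proved; one abbreviation (`goodTriples`); no named facts.  The three-region product
(Claim 6.4) and the asymptotic exponents `E_r` are not treated here.

## References

* V. Vassilevska Williams, Y. Xu, Z. Xu, R. Zhou, *New bounds for matrix multiplication: from alpha
  to omega*, SODA 2024, arXiv:2307.07970 (held: `paper:arxiv-2307.07970`): Prop. 6.2, §6.6 (last two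
  paragraphs), §6.7 (Summary), Cor. 4.2. [VassilevskaWilliamsXuXuZhou2024]
-/

noncomputable section

open scoped BigOperators
open Finset

namespace Literature.Computability.AlgebraicComplexity

open Literature.Barriers.MatrixMultiplication (bigCwTensor)

universe u

/-! ## Relabelling a broken copy of `𝒯*` onto a reference copy -/

section Relabel

variable (R : Type u) [CommSemiring R] (q : ℕ) {c n s : ℕ} (τ : Fin n → Fin s)

/-- **A broken copy of `𝒯*` restricts to a broken reference copy with hole sets of the same sizes**:
if the pair term maps of two level triples have the same fibre sizes, the copy of `𝒯*` over the first,
with hole sets `HX, HY, HZ`, restricts to the copy over the second with hole sets of the same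
cardinalities (transport along the relabelling permutation). [cite: VassilevskaWilliamsXuXuZhou2024, §6.6 ("copies of 𝒯*") and Def. 4.1] -/
theorem brokenStar_restrictsTo_refStar {I J K I₀ J₀ K₀ : Fin (n + n) → ℕ} (h : IsLevelTriple c I J K) (h₀ : IsLevelTriple c I₀ J₀ K₀)
    (hlc : letterCount (pairTermIdx τ h) = letterCount (pairTermIdx τ h₀))
    (βX βY βZ : Fin s → ℕ × ℕ × ℕ → (Fin c → Fin 3) → ℝ) (HX HY HZ : Finset (Fin (n + n) → Fin c → Fin 3)) :
    ∃ HX₀ HY₀ HZ₀ : Finset (Fin (n + n) → Fin c → Fin 3), HX₀.card = HX.card ∧ HY₀.card = HY.card ∧ HZ₀.card = HZ.card ∧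
      TensorRestrictsTo (partSubtensor levelSeq levelSeq levelSeq (starTensor₂ τ R q h βX βY βZ) HXᶜ HYᶜ HZᶜ)
        (partSubtensor levelSeq levelSeq levelSeq (starTensor₂ τ R q h₀ βX βY βZ) HX₀ᶜ HY₀ᶜ HZ₀ᶜ) := by
  obtain ⟨σ₀, hσ₀⟩ := exists_perm_of_letterCount_eq hlc
  -- `hσ₀ : ∀ m, pairTermIdx τ h₀ (σ₀ m) = pairTermIdx τ h m`; put `σ := σ₀⁻¹`
  set σ := σ₀.symm with hσdef
  have hτ : pairTermIdx τ h = pairTermIdx τ h₀ ∘ ⇑σ.symm := by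
    funext v
    simp only [Function.comp_apply, hσdef, Equiv.symm_symm]
    exact (hσ₀ v).symm
  have hcancel : ∀ w : Fin (n + n) → Fin c → Fin 3, chunkPerm σ.symm (chunkPerm σ w) = w := by
    intro w; funext u; simp
  have hcancel' : ∀ w : Fin (n + n) → Fin c → Fin 3, chunkPerm σ (chunkPerm σ.symm w) = w := by
    intro w; funext u; simp
  have himg : ∀ (H : Finset (Fin (n + n) → Fin c → Fin 3)) (w : Fin (n + n) → Fin c → Fin 3),
      w ∉ H.image (chunkPerm σ.symm) ↔ chunkPerm σ w ∉ H := by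
    intro H w
    rw [mem_image]
    constructor
    · rintro hno hmem
      exact hno ⟨chunkPerm σ w, hmem, hcancel _⟩
    · rintro hno ⟨K', hK', hKe⟩
      apply hno
      have : chunkPerm σ w = K' := by rw [← hKe, hcancel']
      rw [this]; exact hK'
  refine ⟨HX.image (chunkPerm σ.symm), HY.image (chunkPerm σ.symm), HZ.image (chunkPerm σ.symm),
    card_image_of_injective _ (chunkPerm σ.symm).injective, card_image_of_injective _ (chunkPerm σ.symm).injective,
    card_image_of_injective _ (chunkPerm σ.symm).injective, ?_⟩
  have key : partSubtensor levelSeq levelSeq levelSeq (starTensor₂ τ R q h₀ βX βY βZ)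
      (HX.image (chunkPerm σ.symm))ᶜ (HY.image (chunkPerm σ.symm))ᶜ (HZ.image (chunkPerm σ.symm))ᶜ =
      fun x y z => partSubtensor levelSeq levelSeq levelSeq (starTensor₂ τ R q h βX βY βZ) HXᶜ HYᶜ HZᶜ
        (chunkPerm σ x) (chunkPerm σ y) (chunkPerm σ z) := by
    funext x y z
    simp only [starTensor₂, partSubtensor_apply, mem_compl, hτ, interfaceTensor_relabel, levelSeq_chunkPerm, himg]
  rw [key]
  exact TensorRestrictsTo.comap _ _ _ _

end Relabel

namespace ConstituentRegion

open scoped Classical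

variable {c n s M : ℕ} {D : ConstituentRegion c n s M}

/-- **`{α_t}`-consistent triples of the universe have pair term maps with the same fibre sizes**
(`|S_{t,i',j',k'}| = cnt_t(i',j',k') + cnt_t(i_t−i',j_t−j',k_t−k')` in the box, `0` outside).
[cite: VassilevskaWilliamsXuXuZhou2024, §6.2 ("consistent with {α_t}") and §6.6] -/
theorem letterCount_pairTermIdx_eq_of_consistent (hD : D.WellFormed)
    {T T' : (Fin (n + n) → Fin (2 * c + 1)) × (Fin (n + n) → Fin (2 * c + 1)) × (Fin (n + n) → Fin (2 * c + 1))}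
    (hT : T ∈ D.consistent) (hT' : T' ∈ D.consistent)
    (h : IsLevelTriple c (seqVal T.1) (seqVal T.2.1) (seqVal T.2.2)) (h' : IsLevelTriple c (seqVal T'.1) (seqVal T'.2.1) (seqVal T'.2.2)) :
    letterCount (pairTermIdx D.τ h) = letterCount (pairTermIdx D.τ h') := by
  obtain ⟨hTu, hcnt⟩ := mem_filter.1 hT
  obtain ⟨hT'u, hcnt'⟩ := mem_filter.1 hT'
  obtain ⟨-, hI, hJ, hK⟩ := tripleSet_good hD hTu
  obtain ⟨-, hI', hJ', hK'⟩ := tripleSet_good hD hT'u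
  funext idx
  obtain ⟨⟨t, sidx⟩, rfl⟩ := finProdFinEquiv.surjective idx
  rw [letterCount_apply, letterCount_apply, filter_pairTermIdx_eq D.τ h t sidx, filter_pairTermIdx_eq D.τ h' t sidx]
  set ijk := ((constituentTriples c).equivFin.symm sidx).1 with hijk
  by_cases hle : ijk.1 ≤ (D.L t).i ∧ ijk.2.1 ≤ (D.L t).j ∧ ijk.2.2 ≤ (D.L t).k
  · rw [card_pairClass_eq D.τ D.L hI hJ hK t hle.1 hle.2.1 hle.2.2, card_pairClass_eq D.τ D.L hI' hJ' hK' t hle.1 hle.2.1 hle.2.2]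
    have e1 := hcnt t ijk
    have e2 := hcnt' t ijk
    have e3 := hcnt t ((D.L t).i - ijk.1, (D.L t).j - ijk.2.1, (D.L t).k - ijk.2.2)
    have e4 := hcnt' t ((D.L t).i - ijk.1, (D.L t).j - ijk.2.1, (D.L t).k - ijk.2.2)
    simp only at e1 e2 e3 e4
    rw [e1, e2, e3, e4]
  · -- outside the box both classes are empty
    have hempty : ∀ {I J K : Fin (n + n) → Fin (2 * c + 1)}, IsLevelTriple c (seqVal I) (seqVal J) (seqVal K) →
        InsideX D.τ D.L I → InsideY D.τ D.L J → InsideZ D.τ D.L K →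
          pairClass D.τ (seqVal I) (seqVal J) (seqVal K) t ijk.1 ijk.2.1 ijk.2.2 = ∅ := by
      intro I J K hl hi hj hk
      rw [Finset.eq_empty_iff_forall_notMem]
      intro p hp
      rw [mem_pairClass] at hp
      obtain ⟨ht, h1, h2, h3⟩ := hp
      have hb := triple_mem_boxTriples D.τ D.L hl hi hj hk p
      rw [mem_boxTriples, ht, h1, h2, h3] at hb
      exact hle hb.2.2
    rw [hempty h hI hJ hK, hempty h' hI' hJ' hK']

variable (D) in
/-- **The good copies**: present triples whose copy of `𝒯*` has at most `h` holes of the second type.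
[cite: VassilevskaWilliamsXuXuZhou2024, §6.6 ("copies of 𝒯* whose fraction of holes is O(1/n²)")] -/
abbrev goodTriples (ω : VxxzSeed M (n + n)) (h : ℕ) :
    Finset ((Fin (n + n) → Fin (2 * c + 1)) × (Fin (n + n) → Fin (2 * c + 1)) × (Fin (n + n) → Fin (2 * c + 1))) :=
  (D.toHashed.present ω).filter fun T => (D.toHashed.holes ω T ∩ D.admZ).card ≤ h

/-- **Second-type holes outside the input are first-type holes**: the hole set of the copy over a present
triple is the union of its first-type holes and its ADMITTED second-type holes. [cite: VassilevskaWilliamsXuXuZhou2024, §6.5–§6.6 (the two types of holes)] -/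
theorem firstTypeHolesZ_union_holes {ω : VxxzSeed M (n + n)} (T : ↥(D.toHashed.present ω))
    (hT : IsLevelTriple c (seqVal T.1.1) (seqVal T.1.2.1) (seqVal T.1.2.2)) :
    firstTypeHolesZ D.τ D.L D.ε hT D.βX D.βY D.βZ ∪ D.toHashed.holes ω T.1 =
      firstTypeHolesZ D.τ D.L D.ε hT D.βX D.βY D.βZ ∪ (D.toHashed.holes ω T.1 ∩ D.admZ) := by
  ext Kh
  simp only [mem_union, mem_inter]
  constructor
  · rintro (hF | hH)
    · exact Or.inl hF
    · by_cases hA : Kh ∈ D.admZ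
      · exact Or.inr ⟨hH, hA⟩
      · -- a useful `Z`-sequence outside the input is a first-type hole
        left
        rw [HashedZeroOut.holes, mem_filter] at hH
        obtain ⟨-, hblk, hu, -⟩ := hH
        rw [firstTypeHolesZ, mem_filter, mem_levelBlocksZ_pair_iff D.τ hT, chunkLevels_eq_iff]
        refine ⟨⟨hblk, ?_⟩, fun hm => hA ((mem_admZ D).2 hm)⟩
        have := hu; rw [toHashed_UZ] at this; exact this
  · rintro (hF | ⟨hH, -⟩)
    · exact Or.inl hF
    · exact Or.inr hH

variable (R : Type u) [CommSemiring R] (q : ℕ)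

/-- **The input restricts to `k` independent copies of `𝒯*`** (§6.6, last paragraph, in exact form): if
`k · r ≤ #{T ∈ 𝒯'(ω) | second-type holes ≤ h}`, `r ≥ 8^{3⌊log_{2N} 3^N⌋+3}` (`N = c · 2n`) and, for
every `{α_t}`-consistent triple, the first-type holes (plus `h` in the `Z`-dimension) are within the
budget `1/(8N)` of the level-1 blocks of the reference `𝒯*`, then `𝒯_{τ,L,ε} ≥ ⟨k⟩ ⊗ 𝒯*`.
[cite: VassilevskaWilliamsXuXuZhou2024, §6.6 ("By Cor. 4.2, we can degenerate them into numalpha · M^{−1−o(1)} unbroken copies of 𝒯*")] -/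
theorem input_restrictsTo_copies (hD : D.WellFormed) (hc : 0 < c) (hn : 0 < n) (ω : VxxzSeed M (n + n)) {h k r : ℕ}
    (hr : 8 ^ (3 * Nat.log (2 * (c * (n + n))) (3 ^ (c * (n + n))) + 3) ≤ r)
    (hkr : k * r ≤ (D.goodTriples ω h).card)
    {T₀ : (Fin (n + n) → Fin (2 * c + 1)) × (Fin (n + n) → Fin (2 * c + 1)) × (Fin (n + n) → Fin (2 * c + 1))}
    (hT₀ : T₀ ∈ D.consistent) (h₀ : IsLevelTriple c (seqVal T₀.1) (seqVal T₀.2.1) (seqVal T₀.2.2))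
    (hHX : ∀ T ∈ D.consistent, ∀ hT : IsLevelTriple c (seqVal T.1) (seqVal T.2.1) (seqVal T.2.2),
      8 * (c * (n + n)) * (firstTypeHolesX D.τ D.L D.ε hT D.βX D.βY D.βZ).card ≤
        (levelBlocksX (pairTermIdx D.τ h₀) (pairTermList c s D.βX D.βY D.βZ) 0).card)
    (hHY : ∀ T ∈ D.consistent, ∀ hT : IsLevelTriple c (seqVal T.1) (seqVal T.2.1) (seqVal T.2.2),
      8 * (c * (n + n)) * (firstTypeHolesY D.τ D.L D.ε hT D.βX D.βY D.βZ).card ≤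
        (levelBlocksY (pairTermIdx D.τ h₀) (pairTermList c s D.βX D.βY D.βZ) 0).card)
    (hHZ : ∀ T ∈ D.consistent, ∀ hT : IsLevelTriple c (seqVal T.1) (seqVal T.2.1) (seqVal T.2.2),
      8 * (c * (n + n)) * ((firstTypeHolesZ D.τ D.L D.ε hT D.βX D.βY D.βZ).card + h) ≤
        (levelBlocksZ (pairTermIdx D.τ h₀) (pairTermList c s D.βX D.βY D.βZ) 0).card) :
    TensorRestrictsTo (interfaceTensor R q D.τ D.L D.ε)
      (kroneckerTensor (unitTensor R k) (starTensor₂ D.τ R q h₀ D.βX D.βY D.βZ)) := by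
  have hN : 0 < n + n := by omega
  -- (1)+(2) zero-outs and the direct sum over the present triples
  have h12 := input_restrictsTo_directSum R q hD ω
  -- (3) `k · r` good copies, indexed by `Fin k × Fin r`
  set g := (D.goodTriples ω h).card with hg
  let eg : Fin g ≃ ↥(D.goodTriples ω h) := (Fintype.equivFinOfCardEq (Fintype.card_coe _)).symm
  have hgood_sub : D.goodTriples ω h ⊆ D.toHashed.present ω := filter_subset _ _
  let j : Fin k × Fin r → ↥(D.goodTriples ω h) := fun p => eg (Fin.castLE hkr (finProdFinEquiv p))
  have hj : Function.Injective j := fun p p' hpp' =>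
    finProdFinEquiv.injective (Fin.castLE_injective hkr (eg.injective hpp'))
  let ι : Fin k × Fin r → ↥(D.toHashed.present ω) := fun p => ⟨(j p).1, hgood_sub (j p).2⟩
  have hι : Function.Injective ι := by
    intro p p' hpp'
    have h' : (ι p).1 = (ι p').1 := congrArg Subtype.val hpp'
    exact hj (Subtype.ext (show (j p).1 = (j p').1 from h'))
  have hιgood : ∀ p, (ι p).1 ∈ D.goodTriples ω h := fun p => (j p).2
  have h3 : TensorRestrictsTo (familyDirectSum fun T : ↥(D.toHashed.present ω) => D.toHashed.summand R q ω T)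
      (familyDirectSum fun p : Fin k × Fin r => D.toHashed.summand R q ω (ι p)) :=
    familyDirectSum_reindex _ hι
  have h4 : TensorRestrictsTo (familyDirectSum fun p : Fin k × Fin r => D.toHashed.summand R q ω (ι p))
      (familyDirectSum fun a : Fin k => familyDirectSum fun b : Fin r => D.toHashed.summand R q ω (ι (a, b))) :=
    familyDirectSum_prod fun a b => D.toHashed.summand R q ω (ι (a, b))
  -- (4) each copy restricts to a broken reference copy with small hole sets
  have hcopy : ∀ (a : Fin k) (b : Fin r), ∃ HX₀ HY₀ HZ₀ : Finset (Fin (n + n) → Fin c → Fin 3),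
      8 * (c * (n + n)) * HX₀.card ≤ (levelBlocksX (pairTermIdx D.τ h₀) (pairTermList c s D.βX D.βY D.βZ) 0).card ∧
      8 * (c * (n + n)) * HY₀.card ≤ (levelBlocksY (pairTermIdx D.τ h₀) (pairTermList c s D.βX D.βY D.βZ) 0).card ∧
      8 * (c * (n + n)) * HZ₀.card ≤ (levelBlocksZ (pairTermIdx D.τ h₀) (pairTermList c s D.βX D.βY D.βZ) 0).card ∧
      TensorRestrictsTo (D.toHashed.summand R q ω (ι (a, b)))
        (partSubtensor levelSeq levelSeq levelSeq (starTensor₂ D.τ R q h₀ D.βX D.βY D.βZ) HX₀ᶜ HY₀ᶜ HZ₀ᶜ) := by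
    intro a b
    have hgd := hιgood (a, b)
    obtain ⟨hpres, hholes⟩ := mem_filter.1 hgd
    have hTα : (ι (a, b)).1 ∈ D.consistent := presentTriples_subset hpres
    have hT := present_isLevelTriple hD (ι (a, b))
    obtain ⟨HX₀, HY₀, HZ₀, hcX, hcY, hcZ, hres⟩ := brokenStar_restrictsTo_refStar R q D.τ hT h₀
      (letterCount_pairTermIdx_eq_of_consistent hD hTα hT₀ hT h₀) D.βX D.βY D.βZ
      (firstTypeHolesX D.τ D.L D.ε hT D.βX D.βY D.βZ) (firstTypeHolesY D.τ D.L D.ε hT D.βX D.βY D.βZ)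
      (firstTypeHolesZ D.τ D.L D.ε hT D.βX D.βY D.βZ ∪ D.toHashed.holes ω (ι (a, b)).1)
    refine ⟨HX₀, HY₀, HZ₀, ?_, ?_, ?_, ?_⟩
    · rw [hcX]; exact hHX _ hTα hT
    · rw [hcY]; exact hHY _ hTα hT
    · rw [hcZ, firstTypeHolesZ_union_holes (ι (a, b)) hT]
      calc 8 * (c * (n + n)) * (firstTypeHolesZ D.τ D.L D.ε hT D.βX D.βY D.βZ ∪ (D.toHashed.holes ω (ι (a, b)).1 ∩ D.admZ)).card
          ≤ 8 * (c * (n + n)) * ((firstTypeHolesZ D.τ D.L D.ε hT D.βX D.βY D.βZ).card + h) :=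
            Nat.mul_le_mul_left _ ((card_union_le _ _).trans (Nat.add_le_add_left hholes _))
        _ ≤ _ := hHZ _ hTα hT
    · rw [summand_eq_brokenStar R q hD (ι (a, b)) hT]
      exact hres
  choose HX₀ HY₀ HZ₀ hHX₀ hHY₀ hHZ₀ hres using hcopy
  -- (5) Cor. 4.2 on each batch
  have hbatch : ∀ a : Fin k, TensorRestrictsTo (familyDirectSum fun b : Fin r => D.toHashed.summand R q ω (ι (a, b)))
      (starTensor₂ D.τ R q h₀ D.βX D.βY D.βZ) := by
    intro a
    refine (familyDirectSum_mono fun b => hres a b).trans ?_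
    exact vxxz2024_cor42 R q hc hN (pairTermIdx D.τ h₀) (pairTermList c s D.βX D.βY D.βZ)
      (HX₀ a) (HY₀ a) (HZ₀ a) (hHX₀ a) (hHY₀ a) (hHZ₀ a) hr
  have h5 : TensorRestrictsTo
      (familyDirectSum fun a : Fin k => familyDirectSum fun b : Fin r => D.toHashed.summand R q ω (ι (a, b)))
      (kroneckerTensor (unitTensor R k) (starTensor₂ D.τ R q h₀ D.βX D.βY D.βZ)) := by
    rw [← familyDirectSum_const]
    exact familyDirectSum_mono hbatch
  exact h12.trans (h3.trans (h4.trans h5))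

/-- The universe of the constituent stage is a family of level triples. [cite: VassilevskaWilliamsXuXuZhou2024, §6.2] -/
theorem isLevelFamily_tripleSet : IsLevelFamily (2 * c) D.toHashed.𝒯 :=
  fun _ hT p => levelSum_of_mem_tripleUniverse hT p

variable [Fact M.Prime]

/-- **VXXZ Proposition 6.2, one region, exact form.**  Let `D` be well-formed data of one region of the
constituent stage, `M` an odd prime with `2c < M`, `n, c ≥ 1`, `B ⊆ ℤ/M` without non-trivial 3-term
progressions, and assume the requirements on `M` of §6.2 and §6.6 in counting form:
`8 · numtriple ≤ M · numxblock`, `8 · numtriple ≤ M · numyblock` and, for every `{α_t}`-consistent `T`,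
`10 U(T) M^{2n−1} ≤ (h+1) M^{2n}` (second-type holes inside the input, `holePairsIn admZ`), together with the
hole budgets of Cor. 4.2 for the
first-type holes (plus `h`).  Then for every `r ≥ 8^{3⌊log_{2N} 3^N⌋+3}` and every reference
`{α_t}`-consistent triple `T₀`, **`𝒯_{τ,L,ε} ≥ ⟨⌊|B| · numalpha / (2 M² r)⌋⟩ ⊗ 𝒯*_{T₀}`** — the printed
"`numalpha · M₀^{−1−o(1)}` unbroken copies of `𝒯*`" with all constants explicit (`𝒯*_{T₀} = starTensor₂`,
the level-`(ℓ−1)` interface tensor with parameter list `{(|S_{t,i',j',k'}|, i', j', k', β_{X,t,i'j'k'}, …)}`).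
[cite: VassilevskaWilliamsXuXuZhou2024, Prop. 6.2 (one region) and §6.6–§6.7] -/
theorem vxxz2024_prop62_region (hD : D.WellFormed) (hM : M ≠ 2) (hcM : 2 * c < M) (hc : 0 < c) (hn : 0 < n)
    (hB : ThreeAPFree (D.B : Set (ZMod M)))
    (h8X : 8 * D.tripleSet.card ≤ M * (pairTypeClass D.τ D.kX).card)
    (h8Y : 8 * D.tripleSet.card ≤ M * (pairTypeClass D.τ D.kY).card) {h : ℕ}
    (hU : ∀ T ∈ D.consistent, 10 * ((D.toHashed.holePairsIn D.admZ T).card * M ^ (n + n - 1)) ≤ (h + 1) * M ^ (n + n))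
    {T₀ : (Fin (n + n) → Fin (2 * c + 1)) × (Fin (n + n) → Fin (2 * c + 1)) × (Fin (n + n) → Fin (2 * c + 1))}
    (hT₀ : T₀ ∈ D.consistent) (h₀ : IsLevelTriple c (seqVal T₀.1) (seqVal T₀.2.1) (seqVal T₀.2.2))
    (hHX : ∀ T ∈ D.consistent, ∀ hT : IsLevelTriple c (seqVal T.1) (seqVal T.2.1) (seqVal T.2.2),
      8 * (c * (n + n)) * (firstTypeHolesX D.τ D.L D.ε hT D.βX D.βY D.βZ).card ≤
        (levelBlocksX (pairTermIdx D.τ h₀) (pairTermList c s D.βX D.βY D.βZ) 0).card)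
    (hHY : ∀ T ∈ D.consistent, ∀ hT : IsLevelTriple c (seqVal T.1) (seqVal T.2.1) (seqVal T.2.2),
      8 * (c * (n + n)) * (firstTypeHolesY D.τ D.L D.ε hT D.βX D.βY D.βZ).card ≤
        (levelBlocksY (pairTermIdx D.τ h₀) (pairTermList c s D.βX D.βY D.βZ) 0).card)
    (hHZ : ∀ T ∈ D.consistent, ∀ hT : IsLevelTriple c (seqVal T.1) (seqVal T.2.1) (seqVal T.2.2),
      8 * (c * (n + n)) * ((firstTypeHolesZ D.τ D.L D.ε hT D.βX D.βY D.βZ).card + h) ≤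
        (levelBlocksZ (pairTermIdx D.τ h₀) (pairTermList c s D.βX D.βY D.βZ) 0).card)
    {r : ℕ} (hr : 8 ^ (3 * Nat.log (2 * (c * (n + n))) (3 ^ (c * (n + n))) + 3) ≤ r) :
    TensorRestrictsTo (interfaceTensor R q D.τ D.L D.ε)
      (kroneckerTensor (unitTensor R (D.B.card * D.consistent.card / (2 * M ^ 2 * r))) (starTensor₂ D.τ R q h₀ D.βX D.βY D.βZ)) := by
  have hN : 0 < n + n := by omega
  have hdegX : ∀ T ∈ D.toHashed.𝒯α, 8 * (D.toHashed.𝒯.filter fun T' => T'.1 = T.1).card ≤ M :=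
    fun T hT => eight_mul_degX_le h8X (filter_subset _ _ hT)
  have hdegY : ∀ T ∈ D.toHashed.𝒯α, 8 * (D.toHashed.𝒯.filter fun T' => T'.2.1 = T.2.1).card ≤ M :=
    fun T hT => eight_mul_degY_le h8Y (filter_subset _ _ hT)
  obtain ⟨ω, hω⟩ := HashedZeroOut.exists_seed_many_goodIn_copies (wellFormed hD) isLevelFamily_tripleSet hM hcM hN
    (by simpa using hB) hdegX hdegY D.admZ (h := h) (by simpa using hU)
  refine input_restrictsTo_copies R q hD hc hn ω hr ?_ hT₀ h₀ hHX hHY hHZ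
  -- `⌊|B| numalpha / (2M²r)⌋ · r ≤ #good`
  rcases Nat.eq_zero_or_pos r with rfl | hrpos
  · simp
  have hMpos : 0 < M := Nat.Prime.pos Fact.out
  have h2M : 0 < 2 * M ^ 2 := by positivity
  have hω' : D.B.card * D.consistent.card ≤ 2 * M ^ 2 * (D.goodTriples ω h).card := by simpa using hω
  calc D.B.card * D.consistent.card / (2 * M ^ 2 * r) * r
      = D.B.card * D.consistent.card / (2 * M ^ 2) / r * r := by rw [Nat.div_div_eq_div_mul]
    _ ≤ D.B.card * D.consistent.card / (2 * M ^ 2) := Nat.div_mul_le_self _ _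
    _ ≤ (D.goodTriples ω h).card := by
        rw [Nat.div_le_iff_le_mul_add_pred h2M]
        exact hω'.trans (Nat.le_add_right _ _)

end ConstituentRegion

end Literature.Computability.AlgebraicComplexity
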